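import Summits.AtomisticToContinuum.FouriersLaw.Theses.PhononMeanFreePath
import Summits.AtomisticToContinuum.FouriersLaw.Theorems.PhononMeanFreePathDefs
import Summits.AtomisticToContinuum.FouriersLaw.Theorems.PhononMeanFreePathCoherentDephasingWeakCouplingIntegrability
import Summits.AtomisticToContinuum.FouriersLaw.Theorems.PhononMeanFreePathCoherentDephasingResponseRegularity
import Summits.AtomisticToContinuum.FouriersLaw.Theorems.PhononMeanFreePathCoherentDephasingMeanFieldDuhamel
import Summits.AtomisticToContinuum.FouriersLaw.Theorems.PhononMeanFreePathCoherentDephasingHarmFluxBound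
import Summits.AtomisticToContinuum.FouriersLaw.Theorems.PhononMeanFreePathCoherentDephasingSiteBookkeeping
import Summits.AtomisticToContinuum.FouriersLaw.Theorems.PhononMeanFreePathCoherentDephasingTelescoping
import Summits.AtomisticToContinuum.FouriersLaw.Theorems.PhononMeanFreePathCoherentDephasingLossComposition
import Summits.AtomisticToContinuum.FouriersLaw.Theorems.PhononMeanFreePathCoherentDephasingOfLocalLossBound
import Summits.AtomisticToContinuum.FouriersLaw.Theorems.PhononMeanFreePathCoherentDephasingResponseAbsBounds

/-!
# The coherent LIFETIME bound from a BLOCK loss bound (line `Sketch`, crux stmt-AtomisticToContinuum-11810)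

Registered stub `lifetimeBound_of_blockLossBound` of the lead's skeleton of line `Sketch` (coherent-field
Beer–Lambert) of the crux `PhononMeanFreePath.CoherentDephasing`. For the `(N+1)`-site pinned anharmonic chain with
Langevin baths at sites `0` and `N`, write `E_x = cohEnergy x ≥ 0` for the time-integrated coherent site energies of
the Gibbs-averaged linear response to a momentum kick at site `0`, `Ĵ_b = harmFlux b` for the symmetric harmonic
fluxes and `s'_x = siteWork x + γ([x = 0] + [x = N]) ∫₀^∞ m_x²` for the total local loss. The HYPOTHESIS is the open
block loss bound of the line (verbatim the registered stub `stub_blockLossBound`): there are `L₀ ≥ 1`, `L`, `N₀`,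
`κ > 0` with `κ Σ_{i<L₀} E_{x+i} ≤ Σ_{i<L₀} s'_{x+i}` for every block of `L₀` consecutive sites `x, …, x + L₀ - 1`
with `L ≤ x`, `x + L₀ ≤ N + 1`, of every chain with `N ≥ N₀`. The CLAIM is the `N`-uniform coherent lifetime bound
`Σ_x E_x ≤ B'` for `N ≥ N₀`.

Proof. Two landed inputs: the exact site balances `Ĵ_{x-1} - Ĵ_x = s'_x` (`1 ≤ x ≤ N`, `Ĵ_N := 0`) of
`…SiteBookkeeping` (applied to `…MeanFieldDuhamel`, `…ResponseRegularity`), and the `N`-uniform absolute bounds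
`E_x ≤ B`, `|Ĵ_b| ≤ B` of `…ResponseAbsBounds`. With `L' = max L 1`, tile the sites from the RIGHT by
`n = ⌊(N + 1 - L')/L₀⌋` blocks of `L₀` sites, the last one ending at `N`, the first one starting at
`a = N + 1 - n L₀`, so `1 ≤ a`, `L ≤ a` (if `n ≥ 1`) and `a < L' + L₀`. Summing the balances over `a ≤ x ≤ N`
telescopes to `Σ_{x ≥ a} s'_x = Ĵ_{a-1} ≤ B`, and summing the block bounds over the `n` blocks gives
`κ Σ_{x ≥ a} E_x ≤ Σ_{x ≥ a} s'_x ≤ B`; the `a ≤ L' + L₀` head sites contribute at most `(L' + L₀) B`. Hence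
`Σ_x E_x ≤ (L' + L₀) B + B/κ`, independent of `N`. The abstract core (`sum_Ico_le_of_blockLoss`) is pure finite-sum
algebra over `ℕ`-indexed families.
-/

noncomputable section

open MeasureTheory Set Filter Topology

namespace Summit.AtomisticToContinuum.FouriersLaw.Theorems.CoherentDephasing.LifetimeOfBlockLoss

open Literature.MathematicalPhysics.KineticTheory.HeatConduction (pinnedChain PhaseSpace)
open Summit.AtomisticToContinuum.FouriersLaw.Theorems.PhononMeanFreePath
open Summit.AtomisticToContinuum.FouriersLaw.Theorems.CoherentDephasing.MeanFieldDuhamel (stub_meanFieldDuhamel)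
open Summit.AtomisticToContinuum.FouriersLaw.Theorems.CoherentDephasing.ResponseRegularity (stub_responseRegularity)
open Summit.AtomisticToContinuum.FouriersLaw.Theorems.CoherentDephasing.SiteBookkeeping (stub_siteBookkeeping_of_meanField)
open Summit.AtomisticToContinuum.FouriersLaw.Theorems.CoherentDephasing.ResponseAbsBounds (responseAbsBounds)
open Summit.AtomisticToContinuum.FouriersLaw.Theorems.CoherentDephasing.OfLocalLossBound
  (sum_ite_succ_eq sum_ite_val_eq_of_lt sum_ite_val_eq_zero)

/-! ## Abstract part: finite-sum algebra over `ℕ`-indexed families -/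

/-- A sum over the interval `[a, a + n L₀)` is the sum over the `n` consecutive blocks of `L₀` sites
`a + j L₀, …, a + j L₀ + L₀ - 1`, `j < n`. [folklore] -/
theorem sum_Ico_eq_sum_blocks (f : ℕ → ℝ) (a L₀ n : ℕ) :
    ∑ x ∈ Finset.Ico a (a + n * L₀), f x =
      ∑ j ∈ Finset.range n, ∑ i ∈ Finset.range L₀, f (a + j * L₀ + i) := by
  induction n with
  | zero => simp
  | succ n ih =>
    rw [Finset.sum_range_succ, ← ih, add_one_mul, ← add_assoc,
      ← Finset.sum_Ico_consecutive f (Nat.le_add_right a (n * L₀)) (Nat.le_add_right (a + n * L₀) L₀),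
      Finset.sum_Ico_eq_sum_range f (a + n * L₀) (a + n * L₀ + L₀), Nat.add_sub_cancel_left]

/-- Telescoping over an interval: `Σ_{a ≤ x < a + m} (J (x-1) - J x) = J (a-1) - J (a+m-1)`. [folklore] -/
theorem sum_Ico_sub_eq (J : ℕ → ℝ) (a m : ℕ) :
    ∑ x ∈ Finset.Ico a (a + m), (J (x - 1) - J x) = J (a - 1) - J (a + m - 1) := by
  induction m with
  | zero => simp
  | succ m ih =>
    rw [← add_assoc, Finset.sum_Ico_succ_top (Nat.le_add_right a m), ih, Nat.add_sub_cancel]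
    ring

/-- **Abstract core.** `J, s, E : ℕ → ℝ` (fluxes, total local losses, site energies of a chain with sites `0, …, N`,
`J N = 0`), the sites `a, …, N` tiled by `n` blocks of `L₀` sites (`a + n L₀ = N + 1`), site balances
`J (x-1) - J x = s x` for `a ≤ x ≤ N`, and the block loss bound `κ Σ_block E ≤ Σ_block s` on each of the `n` blocks.
Then `κ Σ_{a ≤ x ≤ N} E x ≤ J (a-1) ≤ B`: the losses telescope, the block bounds add up. [folklore] -/
theorem sum_Ico_le_of_blockLoss (J s E : ℕ → ℝ) (κ B : ℝ) (N a n L₀ : ℕ) (htile : a + n * L₀ = N + 1)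
    (hJN : J N = 0) (hJa : J (a - 1) ≤ B) (hbal : ∀ x, a ≤ x → x ≤ N → J (x - 1) - J x = s x)
    (hloss : ∀ j, j < n →
      κ * ∑ i ∈ Finset.range L₀, E (a + j * L₀ + i) ≤ ∑ i ∈ Finset.range L₀, s (a + j * L₀ + i)) :
    κ * ∑ x ∈ Finset.Ico a (N + 1), E x ≤ B := by
  -- the total loss over the covered sites telescopes to `J (a-1) - J N = J (a-1)`
  have htel : ∑ x ∈ Finset.Ico a (N + 1), s x = J (a - 1) := by
    calc ∑ x ∈ Finset.Ico a (N + 1), s x = ∑ x ∈ Finset.Ico a (a + n * L₀), (J (x - 1) - J x) := by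
          rw [htile]
          refine Finset.sum_congr rfl fun x hx => ?_
          rw [Finset.mem_Ico] at hx
          exact (hbal x hx.1 (by omega)).symm
      _ = J (a - 1) := by rw [sum_Ico_sub_eq, show a + n * L₀ - 1 = N by omega, hJN, sub_zero]
  -- the block bounds add up over the exact tiling
  rw [← htile, sum_Ico_eq_sum_blocks E a L₀ n, Finset.mul_sum]
  calc ∑ j ∈ Finset.range n, κ * ∑ i ∈ Finset.range L₀, E (a + j * L₀ + i)
      ≤ ∑ j ∈ Finset.range n, ∑ i ∈ Finset.range L₀, s (a + j * L₀ + i) :=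
        Finset.sum_le_sum fun j hj => hloss j (Finset.mem_range.1 hj)
    _ = J (a - 1) := by rw [← sum_Ico_eq_sum_blocks s a L₀ n, htile, htel]
    _ ≤ B := hJa

/-! ## The stub: the coherent lifetime bound from the block loss bound -/

/-- **Coherent lifetime bound from the block loss bound** (registered stub `lifetimeBound_of_blockLossBound` of line
`Sketch`). If for every admissible parameter point there are a block length `L₀ ≥ 1`, a head margin `L`, a threshold
`N₀` and a rate `κ > 0` such that on every block of `L₀` consecutive sites `x, …, x + L₀ - 1` with `L ≤ x`,
`x + L₀ ≤ N + 1` of every chain with `N ≥ N₀` the total local loss dominates `κ ×` the coherent energy, then the total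
time-integrated coherent energy `Σ_x cohEnergy x` is bounded uniformly in `N ≥ N₀`. Proof: tile the sites from the far
bath by blocks of `L₀` sites down to a head of `< max L 1 + L₀` sites; on the tiled part the losses telescope to one
harmonic flux (`≤ B` by `responseAbsBounds`) and dominate `κ Σ E`; each head site has `cohEnergy ≤ B`. [folklore] -/
theorem lifetimeBound_of_blockLossBound :
    (∀ ω₂ lam β γ : ℝ, 0 < ω₂ → 0 < lam → 0 < β → 0 < γ → ∀ T : ℝ, 0 < T →
      ∃ L₀ L N₀ : ℕ, ∃ κ : ℝ, 0 < L₀ ∧ 0 < κ ∧ ∀ N : ℕ, N₀ ≤ N → ∀ (x : ℕ) (hx : x + L₀ ≤ N + 1), L ≤ x →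
        κ * ∑ i : Fin L₀, cohEnergy ω₂ lam β γ T N ⟨x + i, by omega⟩ ≤
          ∑ i : Fin L₀, (siteWork ω₂ lam β γ T N ⟨x + i, by omega⟩ +
            γ * ((if x + (i : ℕ) = 0 then 1 else 0) + (if x + (i : ℕ) = N then 1 else 0)) *
              ∫ t in Set.Ioi (0 : ℝ), momResp ω₂ lam β γ T N ⟨x + i, by omega⟩ t ^ 2)) →
    ∀ ω₂ lam β γ : ℝ, 0 < ω₂ → 0 < lam → 0 < β → 0 < γ → ∀ T : ℝ, 0 < T →
      ∃ B : ℝ, ∃ N₀ : ℕ, ∀ N : ℕ, N₀ ≤ N → ∑ x : Fin (N + 1), cohEnergy ω₂ lam β γ T N x ≤ B := by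
  intro hLoss ω₂ lam β γ hω hl hβ hγ T hT
  obtain ⟨L₀, L, N₀, κ, hL₀, hκ, hloss⟩ := hLoss ω₂ lam β γ hω hl hβ hγ T hT
  obtain ⟨B, hB⟩ := responseAbsBounds ω₂ lam β γ hω hl hβ hγ T hT
  have hB0 : 0 ≤ B := (cohEnergy_nonneg ω₂ lam β γ T 0 hω.le 0).trans ((hB 0).1 0).1
  -- head margin `L' = max L 1`
  obtain ⟨L', hLL', h1L'⟩ : ∃ L' : ℕ, L ≤ L' ∧ 1 ≤ L' := ⟨max L 1, le_max_left L 1, le_max_right L 1⟩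
  refine ⟨((L' + L₀ : ℕ) : ℝ) * B + B / κ, N₀, fun N hN => ?_⟩
  -- the exact site balances of the chain with sites `0, …, N`
  obtain ⟨hbal, -⟩ := stub_siteBookkeeping_of_meanField ω₂ lam β γ hω hl hβ hγ T hT N
    (stub_meanFieldDuhamel ω₂ lam β γ hω hl hβ hγ T hT N) (stub_responseRegularity ω₂ lam β γ hω hl hβ hγ T hT N)
  -- tiling of the sites `a, …, N` from the right by `n` blocks of `L₀` sites; `1 ≤ a ≤ L' + L₀`
  obtain ⟨n, hn⟩ : ∃ n : ℕ, n = (N + 1 - L') / L₀ := ⟨_, rfl⟩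
  have hnle : n * L₀ ≤ N + 1 - L' := by rw [hn]; exact Nat.div_mul_le_self _ _
  have hnlt : N + 1 - L' < n * L₀ + L₀ := by rw [hn]; exact Nat.lt_div_mul_add hL₀
  obtain ⟨a, ha⟩ : ∃ a : ℕ, a = N + 1 - n * L₀ := ⟨_, rfl⟩
  have htile : a + n * L₀ = N + 1 := by omega
  have haN : a ≤ N + 1 := by omega
  have haL : a ≤ L' + L₀ := by omega
  -- `ℕ`-indexed flux `J`, total local loss `s` and site energy `E` (junk `0` out of range)
  obtain ⟨J, hJ⟩ : ∃ J : ℕ → ℝ, J = fun b => if h : b < N then harmFlux ω₂ lam β γ T N ⟨b, h⟩ else 0 := ⟨_, rfl⟩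
  obtain ⟨s, hs⟩ : ∃ s : ℕ → ℝ, s = fun y => if h : y < N + 1 then siteWork ω₂ lam β γ T N ⟨y, h⟩ +
      γ * ((if y = 0 then 1 else 0) + (if y = N then 1 else 0)) *
        ∫ t in Set.Ioi (0 : ℝ), momResp ω₂ lam β γ T N ⟨y, h⟩ t ^ 2 else 0 := ⟨_, rfl⟩
  obtain ⟨E, hE⟩ : ∃ E : ℕ → ℝ, E = fun y => if h : y < N + 1 then cohEnergy ω₂ lam β γ T N ⟨y, h⟩ else 0 :=
    ⟨_, rfl⟩
  have hEB : ∀ y, E y ≤ B := fun y => by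
    simp only [hE]
    split_ifs with h
    · exact ((hB N).1 ⟨y, h⟩).1
    · exact hB0
  -- the tiled sites: `κ Σ_{a ≤ y ≤ N} E y ≤ J (a-1) ≤ B`
  have htail : κ * ∑ y ∈ Finset.Ico a (N + 1), E y ≤ B := by
    refine sum_Ico_le_of_blockLoss J s E κ B N a n L₀ htile ?_ ?_ ?_ ?_
    · -- `J N = 0`
      simp only [hJ, dif_neg (lt_irrefl N)]
    · -- `J (a-1) ≤ B`
      simp only [hJ]
      split_ifs with h
      · exact (le_abs_self _).trans ((hB N).2 ⟨a - 1, h⟩).1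
      · exact hB0
    · -- the site balances at `a ≤ x ≤ N` (so `1 ≤ x`), read off the bookkeeping stub
      intro x hx1 hx2
      have h := hbal ⟨x, by omega⟩
      rw [sum_ite_succ_eq N _ (show ((⟨x, by omega⟩ : Fin (N + 1)) : ℕ) - 1 < N by simp only; omega)
        (show ((⟨x, by omega⟩ : Fin (N + 1)) : ℕ) ≠ 0 by simp only; omega)] at h
      simp only at h
      rw [if_neg (show x ≠ 0 by omega), add_zero] at h
      simp only [hJ, hs]
      rw [dif_pos (show x - 1 < N by omega), dif_pos (show x < N + 1 by omega)]
      by_cases hxN : x = N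
      · rw [sum_ite_val_eq_zero N _ (show ¬ ((⟨x, _⟩ : Fin (N + 1)) : ℕ) < N by simp only; omega)] at h
        rw [dif_neg (show ¬ x < N by omega)]
        linarith
      · rw [sum_ite_val_eq_of_lt N _ (show ((⟨x, _⟩ : Fin (N + 1)) : ℕ) < N by simp only; omega)] at h
        simp only at h
        rw [dif_pos (show x < N by omega)]
        linarith
    · -- the block loss bounds on the `n` blocks (the hypothesis), moved to `range`-sums of `E`, `s`
      intro j hj
      have hjn : j * L₀ + L₀ ≤ n * L₀ := by
        have h := Nat.mul_le_mul_right L₀ (Nat.succ_le_of_lt hj)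
        rwa [Nat.succ_mul] at h
      have h := hloss N hN (a + j * L₀) (by omega) (by omega)
      have e1 : ∑ i : Fin L₀, cohEnergy ω₂ lam β γ T N ⟨a + j * L₀ + i, by omega⟩ =
          ∑ i : Fin L₀, E (a + j * L₀ + i) := by
        refine Finset.sum_congr rfl fun i _ => ?_
        simp only [hE]
        rw [dif_pos (show a + j * L₀ + (i : ℕ) < N + 1 by omega)]
      have e2 : ∑ i : Fin L₀, (siteWork ω₂ lam β γ T N ⟨a + j * L₀ + i, by omega⟩ +
            γ * ((if a + j * L₀ + (i : ℕ) = 0 then 1 else 0) + (if a + j * L₀ + (i : ℕ) = N then 1 else 0)) *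
              ∫ t in Set.Ioi (0 : ℝ), momResp ω₂ lam β γ T N ⟨a + j * L₀ + i, by omega⟩ t ^ 2) =
          ∑ i : Fin L₀, s (a + j * L₀ + i) := by
        refine Finset.sum_congr rfl fun i _ => ?_
        simp only [hs]
        rw [dif_pos (show a + j * L₀ + (i : ℕ) < N + 1 by omega)]
      rw [e1, e2] at h
      rw [Finset.sum_range, Finset.sum_range]
      exact h
  -- assembly: `a ≤ L' + L₀` head sites with `E ≤ B` each, tiled sites `≤ B / κ` in total
  have hsumE : ∑ x : Fin (N + 1), cohEnergy ω₂ lam β γ T N x = ∑ y ∈ Finset.range (N + 1), E y := by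
    rw [Finset.sum_range]
    refine Finset.sum_congr rfl fun x _ => ?_
    simp only [hE]
    rw [dif_pos x.isLt]
  have hhead : ∑ y ∈ Finset.range a, E y ≤ ((L' + L₀ : ℕ) : ℝ) * B :=
    calc ∑ y ∈ Finset.range a, E y ≤ ∑ _y ∈ Finset.range a, B := Finset.sum_le_sum fun y _ => hEB y
      _ = (a : ℝ) * B := by rw [Finset.sum_const, Finset.card_range, nsmul_eq_mul]
      _ ≤ ((L' + L₀ : ℕ) : ℝ) * B := mul_le_mul_of_nonneg_right (Nat.cast_le.mpr haL) hB0
  have htail' : ∑ y ∈ Finset.Ico a (N + 1), E y ≤ B / κ := by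
    rw [le_div_iff₀ hκ, mul_comm]
    exact htail
  rw [hsumE, ← Finset.sum_range_add_sum_Ico E haN]
  linarith

end Summit.AtomisticToContinuum.FouriersLaw.Theorems.CoherentDephasing.LifetimeOfBlockLoss

end
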